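import Literature.NumberTheory.Transcendental.PhilipponZeroEstimateP1n
import Literature.NumberTheory.Transcendental.PhilipponZeroEstimateP1nDescent
import Literature.NumberTheory.Transcendental.PhilipponZeroEstimateP1nDegreeClause
import Literature.NumberTheory.Transcendental.PhilipponZeroEstimateP1nMultBound
import HarnessLib

/-!
# Proof of `Philippon1986_GaGm_P1n` (Philippon's zero estimate on `𝔾ₐ × 𝔾ₘⁿ ⊂ (ℙ¹)ⁿ⁺¹`, `T = 0`)

Topic `Literature/NumberTheory/Transcendental`. This file DISCHARGES the named fact
`Literature.NumberTheory.Transcendental.Philippon1986_GaGm_P1n` (`PhilipponZeroEstimateP1n.lean`;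
Philippon 1986, Théorème 2.1, case `K = ℂ`, `T = 0`, `G = 𝔾ₐ × 𝔾ₘⁿ` embedded factor by factor in
`(ℙ¹)ⁿ⁺¹`, `cᵢ = 1`): `Philippon1986_GaGm_P1n_holds`.

The proof assembles the toolkit built for this purpose in the tree:

* `GaGmZariski` / `GaGmBezout` (Zariski closed sets of `G(ℂ) = ℂ × (ℂˣ)ⁿ` for the box filtration,
  dimension, multiplicity `mult`, and the Bézout inequality `sum_mult_le_of_subset_Box` — Philippon's
  Prop. 3.3 at `T = 0` in the Segre–Veronese embedding, where `(n+1)! D₀ D₁ⁿ = mult(G)`);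
* `GaGmSubgroups` / `GaGmSubgroupDegrees` (closed subgroups, identity component, the structure
  theorem `V × T_A` = `GaGm.toConnAlgSubgroup`, `dim H₀ = dim V + dim T_A` and
  `mult(H₀) ≥ D₀^{dim V} D₁^{dim T_A}` — reading (i));
* `PhilipponZeroEstimateP1nDescent` (`GaGm.exists_obstruction_subgroup`: Philippon's §5 descent at
  `T = 0`, producing the obstruction subgroup `H₀` with the Bézout count
  `card((Σ·H₀)/H₀) · mult(H₀) ≤ (n+1)! D₀ D₁ⁿ`, `H₀` a component of a zero set of box polynomials,
  contained in a translate of `Z(P)`);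
* `PhilipponZeroEstimateP1nMultBound` (`mult(𝔾ₐ × T_λ) ≥ n!·D₀D₁ⁿ⁻¹·∑|λ_h|` — reading (ii));
* `PhilipponZeroEstimateP1nDegreeClause` (the degree clause — reading (iii)).

## References

* P. Philippon, *Lemmes de zéros dans les groupes algébriques commutatifs*, Bull. Soc. Math.
  France 114 (1986), 355–383, Thm 2.1 (p. 358), §3 Prop. 3.3, (*) p. 362, Lemme 3.4, Déf. 3.5,
  §5 pp. 380–383; Errata, ibid. 115 (1987), 397–398. [Philippon1986]
* Yu. V. Nesterenko, P. Philippon (eds.), LNM 1752 (2001), Ch. 11 (D. Roy). [NesterenkoPhilippon2001]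
-/

noncomputable section

namespace Literature.NumberTheory.Transcendental

open GaGm in
/-- **Philippon's zero estimate on `𝔾ₐ × 𝔾ₘⁿ ⊂ ℙ¹ × (ℙ¹)ⁿ`, multiplicity-free, with the degree
clause — proved.** Discharge of the named fact `Philippon1986_GaGm_P1n`: the descent
`GaGm.exists_obstruction_subgroup` gives an irreducible closed subgroup `H₀` with the Bézout count;
`GaGm.toConnAlgSubgroup` identifies it with `V × T_A`; (i) follows from `GaGm.pow_le_mult`, (ii)
from `GaGm.factorial_mul_le_mult_of_charGroup_eq_zmultiples` after dividing by `n!`, (iii) from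
`GaGm.exists_box_chars_of_mem_comps`.
[cite: Philippon1986, Thm 2.1 (p. 358), case T = 0, G = 𝔾ₐ × 𝔾ₘⁿ ⊂ (ℙ¹)ⁿ⁺¹, cᵢ = 1, with §3 (*) p. 362, Lemme 3.4, Déf. 3.5 and §5] -/
theorem Philippon1986_GaGm_P1n_holds : Philippon1986_GaGm_P1n := by
  intro n D₀ D₁ S P hD₀ hD₁ hS h1 hP0 hdeg₀ hdeg hvan
  classical
  -- `P` is a box polynomial of box degrees `(D₀, D₁)`
  have hPB : P ∈ Box (n := n) D₀ D₁ 1 := by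
    rw [mem_Box_iff]
    exact ⟨by simpa using hdeg₀, fun h => by simpa using hdeg h⟩
  -- the descent
  obtain ⟨H₀, hirr, ⟨F, 𝔮, hF, h𝔮, hH⟩, hcont, hcount⟩ :=
    exists_obstruction_subgroup hD₀ hD₁ hS h1 hP0 hPB hvan
  refine ⟨toConnAlgSubgroup H₀ hirr, ?_, ?_, ?_, ?_⟩
  · -- contained in a translate of `Z(P)`
    rw [toSubgroup_toConnAlgSubgroup]
    exact hcont
  · -- (i): `mult(H₀) ≥ D₀^{dim V} D₁^{dim T_A}`
    rw [toSubgroup_toConnAlgSubgroup]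
    calc Set.ncard ((QuotientGroup.mk : GaGm n → GaGm n ⧸ H₀) '' S) *
          D₀ ^ (toConnAlgSubgroup H₀ hirr).addDim * D₁ ^ (toConnAlgSubgroup H₀ hirr).torusDim
        = Set.ncard ((QuotientGroup.mk : GaGm n → GaGm n ⧸ H₀) '' S) *
          (D₀ ^ (toConnAlgSubgroup H₀ hirr).addDim * D₁ ^ (toConnAlgSubgroup H₀ hirr).torusDim) := by ring
      _ ≤ Set.ncard ((QuotientGroup.mk : GaGm n → GaGm n ⧸ H₀) '' S) * mult D₀ D₁ (H₀ : Set (GaGm n)) :=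
          Nat.mul_le_mul_left _ (pow_le_mult hD₀ hD₁ H₀ hirr)
      _ ≤ (n + 1).factorial * D₀ * D₁ ^ n := hcount
  · -- (ii): `mult(𝔾ₐ × T_λ) ≥ n!·D₀D₁ⁿ⁻¹·∑|λ_h|`, then divide by `n!`
    intro lam hadd hchars
    rw [toSubgroup_toConnAlgSubgroup]
    have hlam : charGroup (H₀ : Set (GaGm n)) = AddSubgroup.zmultiples lam := by
      rw [← toConnAlgSubgroup_chars H₀ hirr]; exact hchars
    have hm := factorial_mul_le_mult_of_charGroup_eq_zmultiples hD₀ hD₁ H₀ hirr hadd hlam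
    have h1 := (Nat.mul_le_mul_left (Set.ncard ((QuotientGroup.mk : GaGm n → GaGm n ⧸ H₀) '' S)) hm).trans hcount
    rw [Nat.factorial_succ] at h1
    refine Nat.le_of_mul_le_mul_left ?_ (Nat.factorial_pos n)
    calc n.factorial * (Set.ncard ((QuotientGroup.mk : GaGm n → GaGm n ⧸ H₀) '' S) * D₀ * D₁ ^ (n - 1) *
          ∑ h, (lam h).natAbs)
        = Set.ncard ((QuotientGroup.mk : GaGm n → GaGm n ⧸ H₀) '' S) *
          (n.factorial * D₀ * D₁ ^ (n - 1) * ∑ h, (lam h).natAbs) := by ring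
      _ ≤ (n + 1) * n.factorial * D₀ * D₁ ^ n := h1
      _ = n.factorial * ((n + 1) * D₀ * D₁ ^ n) := by ring
  · -- (iii): the degree clause
    exact exists_box_chars_of_mem_comps hF H₀ hirr h𝔮 hH

end Literature.NumberTheory.Transcendental
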